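import Literature.AnabelianGeometry.SemiGraphs.TemperedReconstructionR2bHomProofs
import Literature.AnabelianGeometry.SemiGraphs.TemperedReconstructionCompat
import Literature.AnabelianGeometry.SemiGraphs.TemperedThm37OfCompactInVerticial
import HarnessLib

/-!
# [SemiAnbd] Cor. 3.9, step (b): the residual `QuasiGeometricGraphDataCompat` (R2′) DISCHARGED modulo
# Theorem 3.7 — and modulo Thm 3.7 (iii) `CompactInVerticial` alone

Mochizuki, *Semi-graphs of anabelioids*, Publ. RIMS **42** (2006) [MochizukiSemiAnbd2006], Cor. 3.9,
proof, PRIMS pp. 267–268 (kurims pp. 42–43) [cite: MochizukiSemiAnbd2006, Cor 3.9 pp.42-43].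
PROOF-ONLY closers (cell abc-iut, layer L3, sub-node «R2 remainder (b2)», ruling χ2): the named twin
residual `ProfiniteSemiGraph.QuasiGeometricGraphDataCompat` of abc-iut-L3-t2's
`TemperedReconstructionCompat.lean` (R2 over the compatible reading `IsCompatiblyQuasiGeometric` of
Def. 3.8) follows from Thm 3.7 (i)–(iv) + `EdgeLikeDistinct` by `exists_hom_of_isQuasiGeometric_of_compat`
(`TemperedReconstructionR2bHomProofs.lean`), hence — binding the landed `verticialInjective_holds`,
`verticialDistinct_holds` and abc-iut-L3-t11's reductions of (iv) and of `EdgeLikeDistinct` to (iii) —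
from Thm 3.7 (iii) `CompactInVerticial` ALONE.  The literal `QuasiGeometricGraphData` stays OPEN AS TYPED
(false for "folds": findings W4d083-F1 / t2g2-F1).  Nothing here takes a side on [IUTchIII] Cor. 3.12;
typed ≠ discharged.
-/

namespace Literature.AnabelianGeometry.SemiGraphs

namespace ProfiniteSemiGraph

universe u

/-- **(R2′) `QuasiGeometricGraphDataCompat` from Theorem 3.7 (i)–(iv) and `EdgeLikeDistinct`**: a compatibly
quasi-geometric `φ` admits a locally open morphism of semi-graphs of anabelioids `G → H` compatible with it
on verticial and edge homomorphisms ([SemiAnbd] Cor. 3.9, proof, pp. 267–268).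
[cite: MochizukiSemiAnbd2006, Cor 3.9 pp.42-43] -/
theorem quasiGeometricGraphDataCompat_of_thm37 (h37i : VerticialInjective.{u})
    (h37ii : VerticialDistinct.{u}) (h37iii : CompactInVerticial.{u})
    (h37iv : MaximalCompactIffVerticial.{u}) (hED : EdgeLikeDistinct.{u}) :
    QuasiGeometricGraphDataCompat.{u} :=
  fun _ _ h𝒢 hℋ c𝒢 cℋ φ hφ =>
    exists_hom_of_isQuasiGeometric_of_compat h37i h37ii h37iii h37iv hED h𝒢 hℋ c𝒢 cℋ φ
      hφ.isQuasiGeometric hφ.compat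

/-- **(R2′) `QuasiGeometricGraphDataCompat` from Theorem 3.7 (iii) alone** ((i), (ii) are discharged in the
tree; (iv) and `EdgeLikeDistinct` reduce to (i)–(iii) by abc-iut-L3-t11).
[cite: MochizukiSemiAnbd2006, Cor 3.9 pp.42-43] -/
theorem quasiGeometricGraphDataCompat_of_compactInVerticial (h37iii : CompactInVerticial.{u}) :
    QuasiGeometricGraphDataCompat.{u} :=
  quasiGeometricGraphDataCompat_of_thm37 verticialInjective_holds verticialDistinct_holds h37iii
    (maximalCompactIffVerticial_of_compactInVerticial h37iii) (edgeLikeDistinct_of_compactInVerticial h37iii)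

end ProfiniteSemiGraph

end Literature.AnabelianGeometry.SemiGraphs
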